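import Summits.Ventures.QEC.CircuitDistance.ETowerIdent345X
import Summits.Ventures.QEC.CircuitDistance.ETowerTopJ
import HarnessLib

/-!
# #345 E-fold tower (`[[144,12,12]]` under CNOT order #345, W = 10, node J), sector X: SOUNDNESS OF THE K-FILE CONTINUATIONS
# `ktop / nodeC / nodeB / nodeA` and of the WINDOW scheme (cell `qec`, experiment CDX; seat qec-cdx-type-2 g1; the #345 twin of
# type-1's `ETowerNodesX`, STEP2-ASSEMBLY-SPEC §B6/§B7)

Over eng-1's landed `ETowerK345X` (shapes: `ktop = ktopG …` by `rfl`; `nodeC = nodeGdJ …` — the guarded short-cut over the SLIM node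
`nodeJ`, `ETowerTopJ` (crit-1 g3 reference e2af8899ce1f651d); `nodeB / nodeA = nodeJ …`, soundness `ETowerLeverJSound.nodeJ_sound`)
and the identities of `ETowerIdent345X`: the nested predicates `QT` (top), `NC`, `NB` (W = 10) and the facts the composed tower
`kc_of_tower` consumes — `hktop345`, `hkC345` (given the 13 low-weight classes `W3C` certified: `hW3`), `hkB345`, `hkA345`, the closures
`hNC345 / hNB345`, and `hW3_of_wins345`: the 13 × 8 window facts (eng-1's `ETowerWin345X*`:
`nodeCW (W3L.getD k []) (W3WIN3.getD j (0,0)) = true`) give `hW3` (cover / bounds / `W3C = W3L.map Fold.maskOf` decided here; the last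
window `(89,177)` also covers the 176 outside slots of the four-element words).  No `native_decide`; nothing here asserts a value of `d_circ`.
-/

set_option maxRecDepth 100000
set_option exponentiation.threshold 1024

namespace Summit.Ventures.QEC.CircuitDistance.ETower.Sec345X

open Summit.Ventures.QEC.Census Summit.Ventures.QEC.Census.Fold Summit.Ventures.QEC.CircuitDistance.ETower K2

/-! ## The nested predicates (W = 10) -/

/-- TOP predicate of the #345 X tower: kernel word ⇒ all logical parities (`d345X.lg`) vanish, or an anchored translate is in `TOPS`. -/
def QT : ℕ → Prop := QTop 12 6 5 col0 lgR TOPS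
/-- level-C fibre property of a 180-slot word of `E₁(#345)`, weight budget 10. -/
def NC : ℕ → Prop := GoodFibK GC 5 col0 10 QT
/-- level-B fibre property of a 90-slot word of `E₂(#345)`, weight budget 10. -/
def NB : ℕ → Prop := GoodFibK GB 5 col1 10 NC

/-- `QT` is closed under un-translating. -/
theorem hQT345 : ∀ da db u, Sec345X.QT (transWK Sec345X.GC.l Sec345X.GC.m 5 da db u) → Sec345X.QT u := hQT TOPS
/-- `NC` is closed under un-translating (small torus of C = big torus of B). -/
theorem hNC345 : ∀ da db v, Sec345X.NC (transWK Sec345X.GB.l Sec345X.GB.m 5 da db v) → Sec345X.NC v :=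
  fun da db v h => goodFibK_transWK_closed (G := GC) SecZ.shapeC SecZ.okC hK0 hQT345 da db v h
/-- `NB` is closed under un-translating. -/
theorem hNB345 : ∀ da db v, Sec345X.NB (transWK Sec345X.GA.l Sec345X.GA.m 5 da db v) → Sec345X.NB v :=
  fun da db v h => goodFibK_transWK_closed (G := GB) SecZ.shapeB SecZ.okB hK1 hNC345 da db v h

/-! ## The logical table of the K file is the record's (true by construction of `d345X.lg`; decided, pointwise form) -/

/-- KERNEL: the tower's `TLG` = the record `lg` (`d345X`) on all `nK GC 5 = 360` slots. -/
theorem hTLG345 : ∀ J, J < nK Sec345X.GC 5 → tab Sec345X.TLG 12 J = Sec345X.lgR J := by decide +kernel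

/-! ## Soundness of the continuations -/

/-- **`ktop` soundness** (#345 X). -/
theorem hktop345 : ∀ S, (∀ J ∈ S, J < nK Sec345X.GC 5) → S.length = popc (nK Sec345X.GC 5) (Fold.maskOf S) → Sec345X.ktop S = true → Sec345X.QT (Fold.maskOf S) := by
  intro S hS _ h
  change ktopG 12 6 (fun j => tab TLG 12 j) md0 TOPS S = true at h
  exact ktopG_sound (nb := 5) (syn := col0) hTLG345 hS h

/-- **`nodeC` soundness** (guarded short-cut over `nodeJ`), given the 13 low-weight classes certified. -/
theorem hkC345 (hW3 : ∀ r ∈ Sec345X.W3C, Sec345X.NC r) : ∀ S, (∀ j ∈ S, j < nsK Sec345X.GC 5) → Sec345X.nodeC S = true → Sec345X.NC (Fold.maskOf S) := by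
  intro S hS h
  change nodeGdJ GC 180 (tab TFC 72) (tab TPC 72) 10 ktop (fun S => decide (S.length ≤ 4)) md0 W3C S = true at h
  exact nodeGdJ_sound (G := GC) SecZ.shapeC SecZ.okC hK0 hMC hMpC hQT345 hktop345 hW3 hS h

/-- **`nodeB` soundness** (slim node `nodeJ`). -/
theorem hkB345 (hW3 : ∀ r ∈ Sec345X.W3C, Sec345X.NC r) : ∀ S, (∀ j ∈ S, j < nsK Sec345X.GB 5) → Sec345X.nodeB S = true → Sec345X.NB (Fold.maskOf S) := by
  intro S hS h
  exact nodeJ_sound (G := GB) SecZ.shapeB SecZ.okB (hK1 GB.gen.1 GB.gen.2) hMB hMpB (hNC345 GB.gen.1 GB.gen.2)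
    (fun S' hS' _ h' => hkC345 hW3 S' hS' h') hS h

/-- **`nodeA` soundness** (slim node `nodeJ`). -/
theorem hkA345 (hW3 : ∀ r ∈ Sec345X.W3C, Sec345X.NC r) : ∀ S, (∀ j ∈ S, j < nsK Sec345X.GA 5) → Sec345X.nodeA S = true → GoodFibK Sec345X.GA 5 Sec345X.col2 10 Sec345X.NB (Fold.maskOf S) := by
  intro S hS h
  exact nodeJ_sound (G := GA) SecZ.shapeA SecZ.okA (hK2 GA.gen.1 GA.gen.2) hMA hMpA (hNB345 GA.gen.1 GA.gen.2)
    (fun S' hS' _ h' => hkB345 hW3 S' hS' h') hS h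

/-! ## The windows give the low-weight classes -/

/-- KERNEL: `W3C` lists exactly the masks of `W3L` (13 words of lengths 3 and 4), the window family `W3WIN3` has a window starting
at 0, and it covers every outside position of every `W3L` word. -/
theorem winCover345 :
    ((Sec345X.W3L.all fun L => (L.all fun j => decide (j < 180)) &&
       (List.range (outsideOf 180 (bitsOf 180 0 (Fold.maskOf L))).length).all fun p =>
         Sec345X.W3WIN3.any fun w => decide (w.1 ≤ p) && decide (p < w.2)) &&
     decide (Sec345X.W3C = Sec345X.W3L.map Fold.maskOf) &&
     decide (∃ w ∈ Sec345X.W3WIN3, w.1 = 0)) = true := by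
  decide +kernel

/-- **The 13 × 8 window facts certify the low-weight classes**: `hW3`. -/
theorem hW3_of_wins345 (hwin : ∀ L ∈ Sec345X.W3L, ∀ w ∈ Sec345X.W3WIN3, Sec345X.nodeCW L w = true) : ∀ r ∈ Sec345X.W3C, Sec345X.NC r := by
  have h := winCover345
  rw [Bool.and_eq_true, Bool.and_eq_true, decide_eq_true_eq, decide_eq_true_eq, List.all_eq_true] at h
  obtain ⟨⟨hall, hW3C⟩, hzero⟩ := h
  intro r hr
  rw [hW3C, List.mem_map] at hr
  obtain ⟨L, hL, rfl⟩ := hr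
  have hLall := hall L hL
  rw [Bool.and_eq_true, List.all_eq_true, List.all_eq_true] at hLall
  obtain ⟨hbnd, hcov⟩ := hLall
  have hSb : ∀ j ∈ L, j < nsK GC 5 := fun j hj => by
    have := hbnd j hj; rw [decide_eq_true_eq] at this; exact lt_of_lt_of_eq this (by decide)
  refine nodeKW_sound (G := GC) SecZ.okC hMC hMpC (k := ktop) (Q := QT) hktop345 hSb W3WIN3 hzero ?_ ?_
  · intro p hp
    have hp' : p < (outsideOf 180 (bitsOf 180 0 (Fold.maskOf L))).length := by
      have e : nsK GC 5 = 180 := by decide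
      rwa [e] at hp
    have := hcov p (List.mem_range.2 hp')
    rw [List.any_eq_true] at this
    obtain ⟨w, hw, hw'⟩ := this
    rw [Bool.and_eq_true, decide_eq_true_eq, decide_eq_true_eq] at hw'
    exact ⟨w, hw, hw'.1, hw'.2⟩
  · intro w hw
    exact hwin L hL w hw

end Summit.Ventures.QEC.CircuitDistance.ETower.Sec345X
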